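import Summits.BirchSwinnertonDyer.Rank1Residual.Additive.KummerModelInertiaScaling
import Summits.BirchSwinnertonDyer.Rank1Residual.Additive.RamifiedOrdinaryLineExponent
import Summits.BirchSwinnertonDyer.Rank1Residual.Additive.KummerDeuringModelGlobal
import Summits.BirchSwinnertonDyer.Rank1Residual.Additive.KummerDeuringModelExplicit
import Summits.BirchSwinnertonDyer.Rank1Residual.Additive.GoodModelInertiaDichotomy
import HarnessLib

/-!
# The KERNEL of the quotient character of the ramified ordinary line of the Kummer–Deuring model
# is the fixing group of `p^{1/e}` — model level, (G-ord) rows, `p ≥ 5`, `e ∈ {3, 4, 6}`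
# (cell `b2b-bsdres`, team n1011, seat p07 (gen 8); row T-ROL-ORD FILE F3a)

HONEST FRAMING (cell `b2b-bsdres`, run/shared/lean/b2b/bsd-rank1-residual/, verbatim in every
file): the goal of the cell is to DELETE the COMBINATION-SHAPED residual classes of the
Birch–Swinnerton-Dyer formula for ALL analytic-rank `≤ 1` elliptic curves over `ℚ` — "full BSD
formula for every rank `≤ 1` curve in class `C`" assembled STRICTLY from published theorems — so
that the rank-`≤ 1` remainder becomes exactly the CONSTRUCTION-SHAPED classes, which are TYPED
(missing-input `Prop`s), NOT attempted. This is not "finishing BSD". Team n1011 (N10/N11): research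
route on the CONSTRUCTION-SHAPED classes X3♯(G-ord)/X4♯(G-ord); prove what is provable now; no
claim beyond stated classes; census output = EVIDENCE, never a Literature fact; RESIDUAL-MAP marks
UNCHANGED; nothing is booked by this file. TOOL theorems only: NO definition, NO named fact, NO
conjecture node.

## What and why

T-ROL-EXP B (`IsRamifiedOrdinaryLine.pow_semistabilityIndex_smul_sub_mem`): on a (G-ord) row at
`p ≥ 5`, `σ^e` acts trivially on `E[p^∞]/C` for every inertial `σ` — the quotient character
`ϑ : I_v → Aut(E[p^∞]/C)` has order DIVIDING `e = semistabilityIndex W p`. Row T-ROL-ORD proves the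
order IS `e` (cc-typer-2's TT v2.1 exact-order input). This file is the MODEL half:

* §0 `smul_eq_self_of_pow_eq_one` — local inertia fixes every root of unity of order prime to `p`
  (A1's argument, exported); `pow_smul_eq_pow_mul` — iterating a Kummer scaling.
* §1 `exists_isRamifiedOrdinaryLine_and_forall_iff_smul_eq` (every binder explicit as in B §2) and
  its (G-ord) wrapper `…_of_typeGOrd` — for `θ ∈ K̄_v` with `θ^e = p`, the Kummer–Deuring model on
  `u = θ^{m'}` (A3 `exists_goodModel_of_kummerElement`; `gcd(e, m') = 1`,
  p16 `coprime_semistabilityIndex_div_gcd`) carries a ramified ordinary line `Lv` with: for every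
  `σ ∈ I_v`, **`σ` trivial on `E[p^∞]/Lv` ⟺ `σ θ = θ`** (F2 `forall_smul_sub_mem_plus_iff_smul_eq`),
  and FREENESS: an inertial `τ` fixing ONE non-zero vector of `E[p^∞]/Lv` fixes `θ` (p05's K3
  dichotomy `smul_sub_mem_plus_of_smul_sub_mem_plus`);
  `exists_mem_absInertia_smul_eq_primitiveRoot_mul` — some `σ ∈ I_v` multiplies `θ` by a PRIMITIVE
  `e`-th root of unity (the Kummer character of the uniformiser `p` of `ℚ_v` is SURJECTIVE onto
  `μ_e`: the tree's PROVED `IsNonarchimedeanLocalField.exists_mem_absInertia_smul_eq_mul`).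

The row half (model-free by uniqueness, the exact order, class forms) is FILE F3b
`RamifiedOrdinaryLineExactOrder`. Serre 1972 §5.6 / Serre–Tate 1968 §2 Cor. 2 on the étale quotient
of the ordinary good model, in Weierstrass coordinates. NOT claimed: `e = 2`; `p ≤ 3`.

References: J.-P. Serre, Invent. Math. 15 (1972) §1.3, §5.6 [Serre1972]; J.-P. Serre, J. Tate,
Ann. of Math. 88 (1968) §2 Thm. 2, Cor. 2 [SerreTate1968]; J. H. Silverman, *AEC* 2nd ed. VII.5.5,
III.10 [SilvermanAEC2009]; cells/n1011/skel/T-ROL-ORD.md.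
-/

set_option autoImplicit false

noncomputable section

open scoped Classical NNReal NumberField Valued

open WeierstrassCurve

universe u
namespace Summit.BirchSwinnertonDyer.Rank1Residual.Additive.GoodModelLine

open NumberField IsDedekindDomain Field IsDedekindDomain.HeightOneSpectrum
  Literature.NumberTheory.GaloisRepresentations Literature.NumberTheory.EllipticCurves
  Literature.NumberTheory.EllipticCurves.GreenbergSelmer
  Literature.NumberTheory.EllipticCurves.EmertonPollackWeston2006
  Literature.NumberTheory.EllipticCurves.Rank1Residual
  Literature.NumberTheory.EllipticCurves.Rank1Residual.Typed
  Summit.BirchSwinnertonDyer.Rank1Residual.X2.GreenbergVatsalReductionDatum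

/-! ## §0 Local inertia fixes the roots of unity of order prime to `p` -/

section RootsOfUnity

variable (p : ℕ) [hp : Fact p.Prime] {v : HeightOneSpectrum (𝓞 ℚ)}

/-- **Local inertia fixes every root of unity of order prime to `p`**: for `σ ∈ I_v`, `η ∈ K̄_v`
with `η^e = 1`, `p ∤ e`: `σ η = η` (`σ(η)/η` is an `e`-th root of unity `≡ 1 (mod 𝔪_w)` since `σ` is
inertial and `η` a unit; A1 `eq_one_of_pow_eq_one_of_specVal_sub_one_lt`). The argument inside A1's
`pow_smul_eq_of_pow_eq_natCast_pow`, exported. (`μ_e ⊂ ℚ_v^{nr}`.) [folklore] -/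
theorem smul_eq_self_of_pow_eq_one (hpv : ((p : ℕ) : 𝓞 ℚ) ∈ v.asIdeal)
    {η : AlgebraicClosure (v.adicCompletion ℚ)} {e : ℕ} (he0 : e ≠ 0) (hpe : ¬ p ∣ e)
    (hη : η ^ e = 1) {σ : absoluteGaloisGroup (v.adicCompletion ℚ)}
    (hσ : σ ∈ absInertia (v.adicCompletion ℚ)) : σ • η = η := by
  obtain ⟨𝔐, h𝔐⟩ := v.localPrimesAbove_nonempty
  set ψ : AlgebraicClosure (v.adicCompletion ℚ) ≃ₐ[v.adicCompletion ℚ] AlgebraicClosure (v.adicCompletion ℚ) :=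
    absoluteGaloisGroup.toAlgEquiv _ σ with hψ
  have hσI' : σ ∈ 𝔐.inertia (absoluteGaloisGroup (v.adicCompletion ℚ)) := by
    rw [inertia_eq_absInertia (specVal_spec v) h𝔐]; exact hσ
  have hσI : ∀ z, specVal v z ≤ 1 → specVal v (ψ z - z) < 1 :=
    (mem_inertia_iff_spectralValuation (specVal_spec v) h𝔐).1 hσI'
  have hη0 : η ≠ 0 := fun h ↦ by
    rw [h, zero_pow he0] at hη; exact zero_ne_one hη
  have hwη : specVal v η = 1 := by
    have h : specVal v η ^ e = 1 := by rw [← map_pow, hη, map_one]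
    exact (pow_eq_one_iff.mp h).resolve_right he0
  set η' : AlgebraicClosure (v.adicCompletion ℚ) := ψ η * η⁻¹ with hη'
  have hη'e : η' ^ e = 1 := by
    rw [hη', mul_pow, ← map_pow, hη, map_one, inv_pow, hη, inv_one, mul_one]
  have hη'1 : specVal v (η' - 1) < 1 := by
    have h1 : η' - 1 = (ψ η - η) * η⁻¹ := by rw [hη', sub_mul, mul_inv_cancel₀ hη0]
    rw [h1, map_mul, map_inv₀, hwη, inv_one, mul_one]
    exact hσI η hwη.le
  have h1 : η' = 1 := eq_one_of_pow_eq_one_of_specVal_sub_one_lt p hpv he0 hη'e hη'1 hpe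
  have : ψ η = η' * η := by rw [hη', inv_mul_cancel_right₀ hη0]
  rw [absoluteGaloisGroup.smul_def, ← hψ, this, h1, one_mul]

/-- Iterating a Kummer scaling: if `σ θ = ζ θ` and `σ ζ = ζ` then `σ^d θ = ζ^d θ`. [folklore] -/
theorem pow_smul_eq_pow_mul {θ ζ : AlgebraicClosure (v.adicCompletion ℚ)}
    {σ : absoluteGaloisGroup (v.adicCompletion ℚ)} (hσθ : σ • θ = ζ * θ) (hσζ : σ • ζ = ζ) (d : ℕ) :
    (σ ^ d) • θ = ζ ^ d * θ := by
  induction d with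
  | zero => rw [pow_zero, one_smul, pow_zero, one_mul]
  | succ d ih =>
    rw [pow_succ', mul_smul, ih, absoluteGaloisGroup.smul_def, map_mul, map_pow,
      ← absoluteGaloisGroup.smul_def, ← absoluteGaloisGroup.smul_def, hσζ, hσθ, pow_succ]
    ring

end RootsOfUnity

/-! ## §1 Model level: the kernel of the quotient character is the fixing group of `θ`, `θ^e = p` -/

section Gord

variable (W : WeierstrassCurve ℚ) [W.IsElliptic] [W.IsGloballyMinimal] (p : ℕ) [hp : Fact p.Prime]
  {v : HeightOneSpectrum (𝓞 ℚ)}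

set_option maxHeartbeats 400000 in -- `hred` by `rfl` through three transports (as in B §2 / F-A3)
/-- **Model level: the ramified ordinary line of the Kummer–Deuring model on `θ^{m'}` (`θ^e = p`),
with the EXACT kernel of its quotient character** — generic form, every binder explicit (`p ≥ 5`,
`v ∋ p`, `ord_p j ≥ 0`, `e = semistabilityIndex W p` with `e ∣ p − 1`, `e ≠ 1`, `e ≠ 2`, `E` bad at
`v`). There is a ramified ordinary line `Lv` (B §2's construction on A3's model for `u := θ^{m'}`,
`m' = ord_pΔ_min / gcd(12, ord_pΔ_min)`) such that (i) for every `σ ∈ I_v`: `σ` acts trivially on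
`E[p^∞]/Lv` iff `σ θ = θ` (F2 `forall_smul_sub_mem_plus_iff_smul_eq` at `u = θ^{m'}`, and
`σ θ^{m'} = θ^{m'} ⟺ σ θ = θ` because `σθ/θ ∈ μ_e` and `gcd(e, m') = 1`), and (ii) FREENESS: an
inertial `τ` with `τ m − m ∈ Lv` for ONE `m ∉ Lv` fixes `θ` (K3
`smul_sub_mem_plus_of_smul_sub_mem_plus` + (i)). [cite: SerreTate1968, §2 Thm. 2 and Cor. 2]
[cite: Serre1972, §5.6 (p. 312)] [cite: SilvermanAEC2009, Prop. VII.5.5 and III.10] -/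
theorem exists_isRamifiedOrdinaryLine_and_forall_iff_smul_eq (hp5 : 5 ≤ p)
    (hpv : ((p : ℕ) : 𝓞 ℚ) ∈ v.asIdeal) (hj : 0 ≤ padicValRat p W.j)
    (hedvd : semistabilityIndex W p ∣ p - 1) (he1 : semistabilityIndex W p ≠ 1)
    (he : semistabilityIndex W p ≠ 2) (hbad : ¬ W.HasGoodReductionAt v)
    {θ : AlgebraicClosure (v.adicCompletion ℚ)}
    (hθ : θ ^ semistabilityIndex W p = ((p : ℕ) : AlgebraicClosure (v.adicCompletion ℚ))) :
    ∃ Lv : LocalDatum ℚ (W.geomPrimaryTorsion p) v, IsRamifiedOrdinaryLine W p Lv ∧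
      (∀ σ ∈ absInertia (v.adicCompletion ℚ),
        ((∀ m : W.geomPrimaryTorsion p,
            absGaloisRestrict ℚ (v.adicCompletion ℚ) σ • m - m ∈ Lv.plus) ↔ σ • θ = θ)) ∧
      (∀ τ ∈ absInertia (v.adicCompletion ℚ), ∀ m : W.geomPrimaryTorsion p, m ∉ Lv.plus →
        absGaloisRestrict ℚ (v.adicCompletion ℚ) τ • m - m ∈ Lv.plus → τ • θ = θ) := by
  let L := AlgebraicClosure (v.adicCompletion ℚ)
  haveI : CharZero L := charZero_of_injective_algebraMap (algebraMap ℚ L).injective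
  set e : ℕ := semistabilityIndex W p with hedef
  set m' : ℕ := padicValInt p W.minimalDiscriminantInt /
    Nat.gcd 12 (padicValInt p W.minimalDiscriminantInt) with hm'
  have he0 : e ≠ 0 := semistabilityIndex_ne_zero p W
  have hpe : ¬ p ∣ e := not_dvd_semistabilityIndex p W hp5
  have hcop : Nat.Coprime e m' := coprime_semistabilityIndex_div_gcd p W
  have he12 := semistabilityIndex_dvd_twelve W p
  have hecase : semistabilityIndex W p = 3 ∨ semistabilityIndex W p = 4 ∨ semistabilityIndex W p = 6 ∨
      semistabilityIndex W p = 12 := by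
    have hle : semistabilityIndex W p ≤ 12 := Nat.le_of_dvd (by norm_num) he12
    interval_cases h : semistabilityIndex W p <;> omega
  have hp0 : ((p : ℕ) : L) ≠ 0 := Nat.cast_ne_zero.mpr hp.out.ne_zero
  have hθ0 : θ ≠ 0 := fun h ↦ by
    rw [h, zero_pow he0] at hθ; exact hp0 hθ.symm
  -- the Kummer element `u = θ^{m'}`, `u^e = p^{m'}`
  have hu : (θ ^ m') ^ semistabilityIndex W p = ((p : ℕ) : L) ^ m' := by
    rw [← pow_mul, mul_comm, pow_mul, hθ]
  obtain ⟨C, W₀, hW₀, hΔ, ⟨hu0, Cs, hC⟩, -⟩ := exists_goodModel_of_kummerElement p W hp5 hpv hj hu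
  haveI := charP_residueField_specVal p hpv
  -- the ordinary point (verbatim from B §2 / F-C2)
  have hord : ∃ P : (W₀.baseChange (AlgebraicClosure (v.adicCompletion ℚ))).toAffine.Point,
      (p : ℤ) • P = 0 ∧ goodReductionHom W₀ (Valuation.integer.integers (specVal v)) hΔ P ≠ 0 := by
    by_cases h3e : 3 ∣ semistabilityIndex W p
    · have h3v : ¬ 3 ∣ padicValInt p W.minimalDiscriminantInt := by
        intro h
        have : 3 ∣ 4 := dvd_trans h3e (semistabilityIndex_dvd_four_of_three_dvd W p h)
        omega
      exact exists_torsion_goodReductionHom_ne_zero_of_residue_c₄_eq_zero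
        (O := (specVal v).valuationSubring) (Valuation.integer.integers (specVal v)) hΔ p hp5
        (dvd_trans h3e hedvd)
        (residue_c₄_eq_zero_of_goodModel W p hpv hW₀ hΔ
          (j_eq_zero_or_padicValRat_j_pos_of_not_three_dvd W p hj h3v))
    · have h4e : 4 ∣ semistabilityIndex W p := by
        rcases hecase with h | h | h | h <;> rw [h] at h3e ⊢ <;> omega
      have h2v : ¬ 2 ∣ padicValInt p W.minimalDiscriminantInt := by
        intro h
        have : 4 ∣ 6 := dvd_trans h4e (semistabilityIndex_dvd_six_of_two_dvd W p h)
        omega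
      exact exists_torsion_goodReductionHom_ne_zero_of_residue_c₆_eq_zero
        (O := (specVal v).valuationSubring) (Valuation.integer.integers (specVal v)) hΔ p hp5
        (dvd_trans h4e hedvd)
        (residue_c₆_eq_zero_of_goodModel W p hpv hW₀ hΔ
          (j_eq_or_padicValRat_j_sub_pos_of_not_two_dvd W p hp5 hj h2v))
  -- the datum with its reduction map (as in F-A3 / B §2)
  let Φ₁ : localPoints W (v.adicCompletion ℚ) ≃+
      ((W.baseChange (v.adicCompletion ℚ)).baseChange (AlgebraicClosure (v.adicCompletion ℚ))).toAffine.Point :=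
    Affine.Point.congrEquiv (baseChange_baseChange_adicCompletion W v).symm
  let Φ : localPoints W (v.adicCompletion ℚ) ≃+
      (W₀.baseChange (AlgebraicClosure (v.adicCompletion ℚ))).toAffine.Point :=
    (Φ₁.trans (VariableChange.pointEquiv _ C)).trans (Affine.Point.congrEquiv hW₀)
  let red : localPoints W (v.adicCompletion ℚ) →+
      (W₀.map (IsLocalRing.residue (specVal v).integer)).toAffine.Point :=
    (goodReductionHom W₀ (Valuation.integer.integers (specVal v)) hΔ).comp Φ.toAddMonoidHom
  have hred : ∀ P, red P = goodReductionHom W₀ (Valuation.integer.integers (specVal v)) hΔ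
      (Affine.Point.congrEquiv hW₀ (VariableChange.pointEquiv _ C
        (Affine.Point.congrEquiv (baseChange_baseChange_adicCompletion W v).symm P))) := fun _ ↦ rfl
  obtain ⟨Lv, hLv⟩ := exists_localDatum_mem_iff_red_eq_zero W p hW₀ hΔ red hred
  -- (i) the kernel of the quotient character
  have hiff : ∀ σ ∈ absInertia (v.adicCompletion ℚ),
      ((∀ m : W.geomPrimaryTorsion p,
          absGaloisRestrict ℚ (v.adicCompletion ℚ) σ • m - m ∈ Lv.plus) ↔ σ • θ = θ) := by
    intro σ hσ
    set ψ : L ≃ₐ[v.adicCompletion ℚ] L := absoluteGaloisGroup.toAlgEquiv _ σ with hψ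
    have hσue : σ • ((θ ^ m') ^ semistabilityIndex W p) = (θ ^ m') ^ semistabilityIndex W p := by
      change ψ ((θ ^ m') ^ semistabilityIndex W p) = _
      rw [hu, map_pow, map_natCast]
    rw [forall_smul_sub_mem_plus_iff_smul_eq W p hW₀ hΔ red hred hord Lv hLv hpv hu0 Cs hC he0 hpe
      hσ hσue]
    -- `σ θ^{m'} = θ^{m'} ↔ σ θ = θ`
    constructor
    · intro h
      set ζ : L := ψ θ * θ⁻¹ with hζ
      have hψθ : ψ θ = ζ * θ := by rw [hζ, inv_mul_cancel_right₀ hθ0]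
      have hζe : ζ ^ e = 1 := by
        rw [hζ, mul_pow, ← map_pow, hθ, map_natCast, inv_pow, hθ, mul_inv_cancel₀ hp0]
      have hζm : ζ ^ m' = 1 := by
        have h1 : ψ (θ ^ m') = θ ^ m' := h
        rw [hζ, mul_pow, ← map_pow, h1, inv_pow, mul_inv_cancel₀ (pow_ne_zero m' hθ0)]
      have hζ1 : ζ = 1 := by
        have hg : ζ ^ (e.gcd m') = 1 := pow_gcd_eq_one.mpr ⟨hζe, hζm⟩
        rwa [Nat.Coprime.gcd_eq_one hcop, pow_one] at hg
      change ψ θ = θ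
      rw [hψθ, hζ1, one_mul]
    · intro h
      have h1 : ψ θ = θ := h
      change ψ (θ ^ m') = θ ^ m'
      rw [map_pow, h1]
  refine ⟨Lv, isRamifiedOrdinaryLine_of_goodModel W p hW₀ hΔ red hred hord Lv hLv hpv hbad, hiff,
    fun τ hτ m hm hτm ↦ ?_⟩
  -- (ii) freeness: K3's dichotomy
  exact (hiff τ hτ).1
    (smul_sub_mem_plus_of_smul_sub_mem_plus W p hW₀ hΔ red hred Lv hLv hp5 hτ hm hτm)

/-- **(G-ord) wrapper** (`p ≥ 5`, `e ≠ 2`): the binders of the generic form discharged from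
`TypeGOrd W p ∧ Addv W p` exactly as in B `…_of_typeGOrd_of_ne_two`.
[cite: SerreTate1968, §2 Thm. 2 and Cor. 2] [cite: Serre1972, §5.6 (p. 312)] -/
theorem exists_isRamifiedOrdinaryLine_and_forall_iff_smul_eq_of_typeGOrd (hp5 : 5 ≤ p)
    (hG : TypeGOrd W p) (hadd : Addv W p) (he : semistabilityIndex W p ≠ 2)
    (hpv : ((p : ℕ) : 𝓞 ℚ) ∈ v.asIdeal) {θ : AlgebraicClosure (v.adicCompletion ℚ)}
    (hθ : θ ^ semistabilityIndex W p = ((p : ℕ) : AlgebraicClosure (v.adicCompletion ℚ))) :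
    ∃ Lv : LocalDatum ℚ (W.geomPrimaryTorsion p) v, IsRamifiedOrdinaryLine W p Lv ∧
      (∀ σ ∈ absInertia (v.adicCompletion ℚ),
        ((∀ m : W.geomPrimaryTorsion p,
            absGaloisRestrict ℚ (v.adicCompletion ℚ) σ • m - m ∈ Lv.plus) ↔ σ • θ = θ)) ∧
      (∀ τ ∈ absInertia (v.adicCompletion ℚ), ∀ m : W.geomPrimaryTorsion p, m ∉ Lv.plus →
        absGaloisRestrict ℚ (v.adicCompletion ℚ) τ • m - m ∈ Lv.plus → τ • θ = θ) := by
  have hj : 0 ≤ padicValRat p W.j := padicValRat_j_nonneg_of_typeGOrd W p hG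
  have hedvd : semistabilityIndex W p ∣ p - 1 :=
    ((typeG_iff_not_subM_and_semistabilityIndex_dvd W p hp5).mp hG.typeG).2
  have he1 := semistabilityIndex_ne_one_of_addv W p hp5 hadd hj
  have hbad : ¬ W.HasGoodReductionAt v := by
    rw [eq_primesEquiv_symm p hpv]
    exact (hasAdditiveReductionAt_of_addv W p hadd).not_hasGoodReductionAt
  exact exists_isRamifiedOrdinaryLine_and_forall_iff_smul_eq W p hp5 hpv hj hedvd he1 he hbad hθ

omit [W.IsElliptic] in
/-- **A local inertia element multiplying `p^{1/e}` by a PRIMITIVE `e`-th root of unity**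
(`e = semistabilityIndex W p`, `p ≥ 5`): the Kummer character `σ ↦ σ(θ)/θ : I_v → μ_e` of
`θ = p^{1/e}` is SURJECTIVE — the tree's PROVED
`IsNonarchimedeanLocalField.exists_mem_absInertia_smul_eq_mul` (Serre 1972 §1.3: `θ_d` is an
isomorphism `Gal(K_d/K_nr) ≃ μ_d`) for the uniformiser `p` of `ℚ_v`
(`irreducible_natCast_valuativeInteger_adicCompletion`), at a primitive `e`-th root of unity of
`K̄_v`. [cite: Serre1972, §1.3 Prop. 1–2] -/
theorem exists_mem_absInertia_smul_eq_primitiveRoot_mul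
    (hpv : ((p : ℕ) : 𝓞 ℚ) ∈ v.asIdeal) {θ : AlgebraicClosure (v.adicCompletion ℚ)}
    (hθ : θ ^ semistabilityIndex W p = ((p : ℕ) : AlgebraicClosure (v.adicCompletion ℚ))) :
    ∃ ζ : AlgebraicClosure (v.adicCompletion ℚ), IsPrimitiveRoot ζ (semistabilityIndex W p) ∧
      ∃ σ ∈ absInertia (v.adicCompletion ℚ), σ • θ = ζ * θ := by
  let L := AlgebraicClosure (v.adicCompletion ℚ)
  haveI : CharZero L := charZero_of_injective_algebraMap (algebraMap ℚ L).injective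
  have he0 : semistabilityIndex W p ≠ 0 := semistabilityIndex_ne_zero p W
  haveI : NeZero ((semistabilityIndex W p : ℕ) : L) := ⟨Nat.cast_ne_zero.mpr he0⟩
  obtain ⟨ζ, hζ⟩ := HasEnoughRootsOfUnity.exists_primitiveRoot L (semistabilityIndex W p)
  -- `p` is a uniformiser of `ℚ_v`
  have hvp : (Rat.HeightOneSpectrum.primesEquiv v : ℕ) = p :=
    Rat.HeightOneSpectrum.primesEquiv_eq_of_natCast_mem v hp.out hpv
  have hirr := Literature.NumberTheory.Automorphic.irreducible_natCast_valuativeInteger_adicCompletion v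
  rw [hvp] at hirr
  obtain ⟨σ, hσ, hσθ⟩ := IsNonarchimedeanLocalField.exists_mem_absInertia_smul_eq_mul
    (Nat.pos_of_ne_zero he0) hirr (z := θ) (by rw [map_natCast]; exact hθ) hζ.pow_eq_one
  exact ⟨ζ, hζ, σ, hσ, hσθ⟩

end Gord

end Summit.BirchSwinnertonDyer.Rank1Residual.Additive.GoodModelLine

end
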